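import Summits.NavierStokesRegularity.NavierStokesRegularity.Theorems.TypeITraceScarL3.Negative.SwirlWitnessTypeI
import Summits.NavierStokesRegularity.NavierStokesRegularity.Theorems.TypeITraceScarL3.Negative.StubCFalseWithoutNS
import HarnessLib

/-!
# The travelling swirl, part 3: (R), (T), SPREAD, and the classical vorticity cut C1′ is false
# without the Navier–Stokes clause

Negative-lane lemma file of the disprover seat `cdisprove-stmt-NavierStokesRegularity-18385`
(`--supports` the item).  Clauses (R) (rate `1/√(−s)`, `C = 1`) and (T) (weakly null top,
`|∫⟨U(s), φ⟩| ≤ 8M_φ|B₁|(−s)`) for every path; the open-set tool «a value `> K` at a point of an open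
set `O` of the slab ⇒ not essentially `≤ K` on `O`» and the singularity criterion; then the SPREAD path
`c(t) = (−t)⁻¹e₀` (`driftCentre` of `StubCSpreadWitness`) and the census theorem
`C1prime_false_without_NS`: the hypothesis `hC1` of `no_spreadExtinctApex_of_C1'`
(`TerminalTraceTypeITraceScarL3StripRepresentative`) with its suitable-weak-solution clause deleted is
FALSE — the divergence-free travelling swirl is its own continuous, smooth-sliced, divergence-free
representative and its vorticity at the escaping centre `c(s)`, `‖c(s)‖ = (−s)⁻¹ > R`, is
`(−s)⁻¹e₂ ≠ 0` at arbitrarily late `s`.  So C1′ is genuinely dynamical (any proof must use the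
vorticity equation); likewise `exteriorVorticityBUTypeI_false_without_NS`: the exterior vorticity
backward-uniqueness statement with Type-I coefficients (`‖U‖ ≤ C/√(−s)`, `‖∇U‖ ≤ C/(−s)`, null top) minus
its Navier–Stokes clause is false.  Not a Navier–Stokes solution; NS regularity is neither proved nor
refuted here.
[folklore; EscauriazaSereginSverak2003 §3–§5; AlbrittonBarker2019 §1]
-/


noncomputable section

set_option linter.dupNamespace false

namespace Summit.NavierStokesRegularity.NavierStokesRegularity.Theorems.TypeITraceScarL3.Negative

open MeasureTheory Set Function Filter Topology Metric TopologicalSpace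
open Literature.Analysis.FluidPDE Literature.Analysis.FluidPDE.ParabolicBump
open scoped NNReal ENNReal InnerProductSpace RealInnerProductSpace

/-! ### (R) the rate, (T) the weakly null top -/

/-- **(R)** `‖U(s, y)‖ ≤ 1/√(−s)` for every (hence a.e.) `y`, `s < 0`. [folklore] -/
theorem swirlTravel_rate (c : ℝ → EuclideanSpace ℝ (Fin 3)) (s : ℝ) (hs : s < 0) :
    ∀ᵐ y : EuclideanSpace ℝ (Fin 3), ‖swirlTravel c s y‖ ≤ 1 / Real.sqrt (-s) :=
  Eventually.of_forall fun y => norm_swirlTravel_le c hs y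

/-- `|∫ ⟨U(s), φ⟩| ≤ 8 M_φ |B₁| (−s)` for `s < 0`. [folklore] -/
theorem abs_integral_inner_swirlTravel_le (c : ℝ → EuclideanSpace ℝ (Fin 3))
    {φ : EuclideanSpace ℝ (Fin 3) → EuclideanSpace ℝ (Fin 3)}
    {Mφ : ℝ} (hMφ : ∀ y, ‖φ y‖ ≤ Mφ) {s : ℝ} (hs : s < 0) :
    |∫ y, ⟪swirlTravel c s y, φ y⟫| ≤
      8 * Mφ * (volume (ball (0 : EuclideanSpace ℝ (Fin 3)) 1)).toReal * (-s) := by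
  have hM0 : 0 ≤ Mφ := (norm_nonneg _).trans (hMφ 0)
  have hns : 0 < -s := by linarith
  have hσ : 0 < Real.sqrt (-s) := Real.sqrt_pos.2 hns
  set V₁r : ℝ := (volume (ball (0 : EuclideanSpace ℝ (Fin 3)) 1)).toReal with hV₁r
  set g : EuclideanSpace ℝ (Fin 3) → ℝ := fun y => Mφ * (1 / Real.sqrt (-s)) *
    (ball (c s) (2 * Real.sqrt (-s))).indicator (fun _ => (1 : ℝ)) y with hg
  have hbound : ∀ y, ‖⟪swirlTravel c s y, φ y⟫‖ ≤ g y := by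
    intro y
    rw [Real.norm_eq_abs]
    calc |⟪swirlTravel c s y, φ y⟫| ≤ ‖swirlTravel c s y‖ * ‖φ y‖ := abs_real_inner_le_norm _ _
      _ ≤ (1 / Real.sqrt (-s) *
            (ball (c s) (2 * Real.sqrt (-s))).indicator (fun _ => (1 : ℝ)) y) * Mφ :=
          mul_le_mul (norm_swirlTravel_le_indicator c hs y) (hMφ y) (norm_nonneg _)
            (mul_nonneg (by positivity) (indicator_nonneg (fun _ _ => zero_le_one) _))
      _ = g y := by rw [hg]; ring
  have hint : Integrable g volume := (integrable_ball_indicator_one _ _).const_mul _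
  have h1 : ‖∫ y, ⟪swirlTravel c s y, φ y⟫‖ ≤ ∫ y, g y :=
    norm_integral_le_of_norm_le hint (Eventually.of_forall hbound)
  rw [Real.norm_eq_abs] at h1
  refine h1.trans (le_of_eq ?_)
  rw [hg, integral_const_mul, integral_ball_indicator_one,
    volume_ball_toReal (c s) (by positivity : (0 : ℝ) < 2 * Real.sqrt (-s)), ← hV₁r, two_sqrt_cube hs]
  field_simp

/-- **(T) weakly null top, pointwise in `s`**: `|∫ ⟨U(s), φ⟩| ≤ ε` for all `s ∈ ]s₀, 0[`. [folklore] -/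
theorem swirlTravel_nullTop_pointwise (c : ℝ → EuclideanSpace ℝ (Fin 3))
    (φ : EuclideanSpace ℝ (Fin 3) → EuclideanSpace ℝ (Fin 3))
    (hφ : ContDiff ℝ (⊤ : ℕ∞) φ) (hφc : HasCompactSupport φ) (ε : ℝ) (hε : 0 < ε) :
    ∃ s₀ : ℝ, s₀ < 0 ∧ ∀ s ∈ Ioo s₀ 0, |∫ y, ⟪swirlTravel c s y, φ y⟫| ≤ ε := by
  obtain ⟨Mφ, hMφ⟩ := hφ.continuous.bounded_above_of_compact_support hφc
  have hM0 : 0 ≤ Mφ := (norm_nonneg _).trans (hMφ 0)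
  set V₁r : ℝ := (volume (ball (0 : EuclideanSpace ℝ (Fin 3)) 1)).toReal with hV₁r
  have hV0 : 0 ≤ V₁r := ENNReal.toReal_nonneg
  have hden : 0 < 8 * Mφ * V₁r + 1 := by positivity
  refine ⟨-(ε / (8 * Mφ * V₁r + 1)), by rw [neg_lt_zero]; positivity, fun s hs => ?_⟩
  refine (abs_integral_inner_swirlTravel_le c hMφ hs.2).trans ?_
  rw [← hV₁r]
  have h1 : -s < ε / (8 * Mφ * V₁r + 1) := by linarith [hs.1]
  calc 8 * Mφ * V₁r * (-s) ≤ 8 * Mφ * V₁r * (ε / (8 * Mφ * V₁r + 1)) := by gcongr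
    _ = ε * (8 * Mφ * V₁r / (8 * Mφ * V₁r + 1)) := by ring
    _ ≤ ε * 1 := by
        gcongr
        rw [div_le_one hden]; linarith
    _ = ε := mul_one ε

/-- **(T) weakly null top**: `∫ ⟨U(s), φ⟩ → 0` as `s → 0⁻`, for every path. [folklore] -/
theorem swirlTravel_nullTop (c : ℝ → EuclideanSpace ℝ (Fin 3))
    (φ : EuclideanSpace ℝ (Fin 3) → EuclideanSpace ℝ (Fin 3))
    (hφ : ContDiff ℝ (⊤ : ℕ∞) φ) (hφc : HasCompactSupport φ) (ε : ℝ) (hε : 0 < ε) :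
    ∃ s₀ : ℝ, s₀ < 0 ∧ ∀ᵐ s ∂(volume.restrict (Ioo s₀ 0)),
      |∫ y, ⟪swirlTravel c s y, φ y⟫| ≤ ε := by
  obtain ⟨s₀, hs₀, h⟩ := swirlTravel_nullTop_pointwise c φ hφ hφc ε hε
  exact ⟨s₀, hs₀, (ae_restrict_iff' measurableSet_Ioo).2 (Eventually.of_forall h)⟩

/-! ### Large values on open sets: the tool for spreadness, loudness and singularity -/

/-- If the travelling swirl exceeds `K` at a point of an open set `O` of the slab (path continuous on
`t < 0`), it is not essentially bounded by `K` on `O`. [folklore] -/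
theorem swirlTravel_not_ae_le_of_mem {c : ℝ → EuclideanSpace ℝ (Fin 3)} (hc : ContDiffOn ℝ 0 c (Iio 0))
    {O : Set (ℝ × EuclideanSpace ℝ (Fin 3))} (hO : IsOpen O)
    (hOsub : O ⊆ Iio 0 ×ˢ (univ : Set (EuclideanSpace ℝ (Fin 3)))) {K : ℝ}
    {z : ℝ × EuclideanSpace ℝ (Fin 3)} (hz : z ∈ O) (hK : K < ‖swirlTravel c z.1 z.2‖) :
    ¬ (∀ᵐ w ∂(volume.restrict O), ‖swirlTravel c w.1 w.2‖ ≤ K) := by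
  intro h
  have hcont : ContinuousOn (fun w : ℝ × EuclideanSpace ℝ (Fin 3) => ‖swirlTravel c w.1 w.2‖) O :=
    ((contDiffOn_swirlTravel (n := 0) hc).continuousOn.mono hOsub).norm
  set Bad : Set (ℝ × EuclideanSpace ℝ (Fin 3)) :=
    O ∩ (fun w : ℝ × EuclideanSpace ℝ (Fin 3) => ‖swirlTravel c w.1 w.2‖) ⁻¹' Ioi K with hBad
  have hBo : IsOpen Bad := hcont.isOpen_inter_preimage hO isOpen_Ioi
  have hmem : z ∈ Bad := ⟨hz, hK⟩
  have hpos : 0 < volume Bad := hBo.measure_pos volume ⟨_, hmem⟩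
  have hnull : volume Bad = 0 := by
    have h2 := (ae_restrict_iff' hO.measurableSet).1 h
    rw [ae_iff] at h2
    refine measure_mono_null (fun w hw => ?_) h2
    rw [mem_setOf_eq, Classical.not_imp, not_le]
    exact ⟨hw.1, hw.2⟩
  exact hpos.ne' hnull

/-- **Singularity criterion**: if for every level `N` and radius `r > 0` the path visits, at some time
`t ∈ ]−r², 0[`, a point with `c(t) + √(−t)e₀ ∈ B_r` and `1/(2√(−t)) > N`, the origin is backward
singular for the travelling swirl. [folklore] -/
theorem swirlTravel_isBackwardSingularPoint {c : ℝ → EuclideanSpace ℝ (Fin 3)}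
    (hc : ContDiffOn ℝ 0 c (Iio 0))
    (hvisit : ∀ r : ℝ, 0 < r → ∀ N : ℝ, ∃ t : ℝ, -(r ^ 2) < t ∧ t < 0 ∧
      ‖c t + Real.sqrt (-t) • parasiticDir‖ < r ∧ N < 1 / (2 * Real.sqrt (-t))) :
    IsBackwardSingularPoint (swirlTravel c) (0 : ℝ × EuclideanSpace ℝ (Fin 3)) := by
  intro r hr
  rw [eLpNorm_exponent_top]
  show essSup (fun z => ‖uncurry (swirlTravel c) z‖ₑ) _ = ⊤
  apply essSup_eq_top_of_forall_exists_lt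
  intro N
  obtain ⟨t, ht1, ht2, hxr, hN⟩ := hvisit r hr N
  set O : Set (ℝ × EuclideanSpace ℝ (Fin 3)) := parabolicCylinder r (0 : ℝ × EuclideanSpace ℝ (Fin 3))
    with hO
  have hOo : IsOpen O := isOpen_Ioo.prod isOpen_ball
  have hOsub : O ⊆ Iio 0 ×ˢ (univ : Set (EuclideanSpace ℝ (Fin 3))) := parabolicCylinder_subset_slab r
  have hcont : ContinuousOn (fun w : ℝ × EuclideanSpace ℝ (Fin 3) => ‖swirlTravel c w.1 w.2‖) O :=
    ((contDiffOn_swirlTravel (n := 0) hc).continuousOn.mono hOsub).norm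
  set Bad : Set (ℝ × EuclideanSpace ℝ (Fin 3)) :=
    O ∩ (fun w : ℝ × EuclideanSpace ℝ (Fin 3) => ‖swirlTravel c w.1 w.2‖) ⁻¹' Ioi (N : ℝ) with hBad
  have hBo : IsOpen Bad := hcont.isOpen_inter_preimage hOo isOpen_Ioi
  have hmem : (t, c t + Real.sqrt (-t) • parasiticDir) ∈ Bad := by
    refine ⟨?_, ?_⟩
    · rw [hO, mem_parabolicCylinder]
      refine ⟨⟨by simpa using ht1, by simpa using ht2⟩, ?_⟩
      simpa using hxr
    · show (N : ℝ) < ‖swirlTravel c t (c t + Real.sqrt (-t) • parasiticDir)‖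
      rw [norm_swirlTravel_peak c ht2]; exact hN
  have hpos : 0 < volume Bad := hBo.measure_pos volume ⟨_, hmem⟩
  refine ⟨Bad, ?_, fun w hw => ?_⟩
  · rw [Measure.restrict_apply hBo.measurableSet, inter_eq_left.2 (inter_subset_left)]
    exact hpos.ne'
  · have hw2 : (N : ℝ) < ‖swirlTravel c w.1 w.2‖ := hw.2
    rw [show ((N : ℝ≥0) : ℝ≥0∞) = ENNReal.ofReal (N : ℝ) by simp, uncurry, ← ofReal_norm]
    exact (ENNReal.ofReal_lt_ofReal_iff ((NNReal.coe_nonneg N).trans_lt hw2)).2 hw2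


/-! ### Peak bookkeeping -/

/-- From `√(−t) < 1/(2(|K|+1))` to `K < 1/(2√(−t))`. [folklore] -/
theorem lt_peak_of_sqrt_lt {K σ : ℝ} (hσ : 0 < σ) (h : σ < 1 / (2 * (|K| + 1))) : K < 1 / (2 * σ) := by
  have hK1 : 0 < |K| + 1 := by positivity
  rw [lt_div_iff₀ (by positivity)] at h ⊢
  have h1 : K * (2 * σ) ≤ |K| * (2 * σ) := mul_le_mul_of_nonneg_right (le_abs_self K) (by positivity)
  nlinarith

/-- From `−t < σ²` (`σ > 0`, `t < 0`) to `√(−t) < σ`. [folklore] -/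
theorem sqrt_neg_lt_of_lt_sq {t σ : ℝ} (hσ : 0 < σ) (h : -t < σ ^ 2) : Real.sqrt (-t) < σ :=
  (Real.sqrt_lt' hσ).2 h

/-! ### The SPREAD path `c(t) = (−t)⁻¹ e₀` and the classical form C1′ of the vorticity cut -/

/-- The drift centre of part 1 (`c(t) = (−t)⁻¹ e₀`) is smooth on `t < 0`. [folklore] -/
theorem contDiffOn_driftCentre {n : ℕ∞} : ContDiffOn ℝ n driftCentre (Iio 0) := by
  have hne : ∀ t ∈ Iio (0 : ℝ), -t ≠ 0 := fun t ht => by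
    simp only [mem_Iio] at ht
    linarith
  have h1 : ContDiffOn ℝ n (fun t : ℝ => (-t)⁻¹) (Iio 0) := contDiffOn_id.neg.inv hne
  exact h1.smul contDiffOn_const

/-- `‖c(t) + √(−t)e₀‖ = (−t)⁻¹ + √(−t)` for the drift centre. [folklore] -/
theorem norm_driftCentre_add_peak {t : ℝ} (ht : t < 0) :
    ‖driftCentre t + Real.sqrt (-t) • parasiticDir‖ = (-t)⁻¹ + Real.sqrt (-t) := by
  rw [driftCentre, ← add_smul, norm_smul, norm_parasiticDir, mul_one,
    Real.norm_of_nonneg (add_nonneg (inv_nonneg.2 (by linarith)) (Real.sqrt_nonneg _))]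

/-- **SPREAD**: the travelling swirl along the drift centre is essentially unbounded on every late
exterior region `]−δ, 0[ × {‖y‖ > R}`. [folklore] -/
theorem swirlSpread_isSpread (δ : ℝ) (hδ : 0 < δ) (R K : ℝ) :
    ¬ (∀ᵐ z ∂(volume.restrict (Ioo (-δ) 0 ×ˢ (closedBall (0 : EuclideanSpace ℝ (Fin 3)) R)ᶜ)),
      ‖swirlTravel driftCentre z.1 z.2‖ ≤ K) := by
  have hR1 : 0 < |R| + 1 := by positivity
  have hK1 : 0 < 1 / (2 * (|K| + 1)) := by positivity
  set τ : ℝ := min (δ / 2) (min (1 / (|R| + 1)) ((1 / (2 * (|K| + 1))) ^ 2 / 2)) with hτ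
  have hτ0 : 0 < τ := lt_min (by positivity) (lt_min (by positivity) (by positivity))
  have hτδ : τ ≤ δ / 2 := min_le_left _ _
  have hτR : τ ≤ 1 / (|R| + 1) := (min_le_right _ _).trans (min_le_left _ _)
  have hτK : τ ≤ (1 / (2 * (|K| + 1))) ^ 2 / 2 := (min_le_right _ _).trans (min_le_right _ _)
  have hσ : 0 < Real.sqrt τ := Real.sqrt_pos.2 hτ0
  have hk : Real.sqrt (-(-τ)) < 1 / (2 * (|K| + 1)) := by
    rw [neg_neg]; exact (Real.sqrt_lt' hK1).2 (by nlinarith)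
  refine swirlTravel_not_ae_le_of_mem (contDiffOn_driftCentre (n := 0))
    (isOpen_Ioo.prod isClosed_closedBall.isOpen_compl) (fun z hz => ⟨hz.1.2, mem_univ _⟩)
    (z := ((-τ : ℝ), driftCentre (-τ) + Real.sqrt (-(-τ)) • parasiticDir))
    ⟨⟨by linarith, by linarith⟩, ?_⟩ ?_
  · show driftCentre (-τ) + Real.sqrt (-(-τ)) • parasiticDir ∈ (closedBall (0 : EuclideanSpace ℝ (Fin 3)) R)ᶜ
    rw [mem_compl_iff, mem_closedBall, dist_zero_right, not_le, norm_driftCentre_add_peak (by linarith),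
      neg_neg]
    have h1 : |R| + 1 ≤ τ⁻¹ := by
      rw [le_inv_comm₀ hR1 hτ0, inv_eq_one_div]; exact hτR
    linarith [le_abs_self R, Real.sqrt_nonneg τ]
  · show K < ‖swirlTravel driftCentre (-τ) (driftCentre (-τ) + Real.sqrt (-(-τ)) • parasiticDir)‖
    rw [norm_swirlTravel_peak driftCentre (by linarith)]
    exact lt_peak_of_sqrt_lt (by rw [neg_neg]; exact hσ) hk

/-- **The classical form C1′ of the vorticity cut (`no_spreadExtinctApex_of_C1'`) is FALSE without the
Navier–Stokes clause (sw)**: the travelling swirl along the drift centre satisfies the five remaining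
antecedent clauses (G), (I), (D), (R), (T) and is SPREAD; it is its own jointly continuous
representative with `C^∞`, classically divergence-free slices — and its vorticity does NOT vanish at the
moving centre `c(s)`, `‖c(s)‖ = 1/(−s) → ∞`, at arbitrarily late times `s`.  So C1′ (exterior
irrotationality of late strip representatives of spread packages) is a genuinely dynamical statement:
any proof must use the vorticity equation.  NOT a statement about Navier–Stokes solutions; NS regularity
is neither proved nor refuted by this. [folklore; EscauriazaSereginSverak2003 §3–§5] -/
theorem C1prime_false_without_NS :
    ¬ (∀ (U : ℝ → EuclideanSpace ℝ (Fin 3) → EuclideanSpace ℝ (Fin 3))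
      (P : ℝ → EuclideanSpace ℝ (Fin 3) → ℝ)
      (G : ℝ → EuclideanSpace ℝ (Fin 3) →
        EuclideanSpace ℝ (Fin 3) →L[ℝ] EuclideanSpace ℝ (Fin 3))
      (M D₀ : ℝ≥0) (C : ℝ),
      (∀ a : ℝ, 0 < a →
        HasWeakSpatialGradientOn
          (parabolicCylinderOpens a (0 : ℝ × EuclideanSpace ℝ (Fin 3))) U G) →
      (∀ a : ℝ, 0 < a →
        typeIBound (parabolicCylinder a (0 : ℝ × EuclideanSpace ℝ (Fin 3))) U P G ≤ M) →
      (∀ z₀ : ℝ × EuclideanSpace ℝ (Fin 3), z₀.1 ≤ 0 →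
        ∀ r : ℝ, 0 < r → cknD r z₀ P ≤ D₀) →
      (∀ s : ℝ, s < 0 →
        ∀ᵐ y : EuclideanSpace ℝ (Fin 3), ‖U s y‖ ≤ C / Real.sqrt (-s)) →
      (∀ φ : EuclideanSpace ℝ (Fin 3) → EuclideanSpace ℝ (Fin 3),
        ContDiff ℝ (⊤ : ℕ∞) φ →
        HasCompactSupport φ → ∀ ε : ℝ, 0 < ε →
        ∃ s₀ : ℝ, s₀ < 0 ∧ ∀ᵐ s ∂(volume.restrict (Ioo s₀ 0)), |∫ y, ⟪U s y, φ y⟫| ≤ ε) →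
      (∀ δ : ℝ, 0 < δ → ∀ R K : ℝ,
        ¬ (∀ᵐ z ∂(volume.restrict
          (Ioo (-δ) 0 ×ˢ (closedBall (0 : EuclideanSpace ℝ (Fin 3)) R)ᶜ)), ‖U z.1 z.2‖ ≤ K)) →
      ∃ δ : ℝ, 0 < δ ∧ ∃ R : ℝ, 0 < R ∧ ∀ ε : ℝ, 0 < ε → ε < δ →
        ∀ V : ℝ → EuclideanSpace ℝ (Fin 3) → EuclideanSpace ℝ (Fin 3),
          uncurry V =ᵐ[volume.restrict
            (Ioo (-δ) (-ε) ×ˢ (univ : Set (EuclideanSpace ℝ (Fin 3))))] uncurry U →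
          ContinuousOn (uncurry V) (Ioo (-δ) (-ε) ×ˢ (univ : Set (EuclideanSpace ℝ (Fin 3)))) →
          (∀ z ∈ Ioo (-δ) (-ε) ×ˢ (univ : Set (EuclideanSpace ℝ (Fin 3))),
            ContDiffAt ℝ (⊤ : ℕ∞) (V z.1) z.2) →
          (∀ z ∈ Ioo (-δ) (-ε) ×ˢ (univ : Set (EuclideanSpace ℝ (Fin 3))),
            VectorCalculus.divergence (V z.1) z.2 = 0) →
          ∀ s ∈ Ioo (-δ) (-ε), ∀ x : EuclideanSpace ℝ (Fin 3), R < ‖x‖ → curl (V s) x = 0) := by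
  intro h
  obtain ⟨M, hM⟩ := typeIBound_swirlTravel_cylinder_le (contDiffOn_driftCentre (n := 1))
  obtain ⟨δ, hδ, R, hR, h'⟩ := h (swirlTravel driftCentre) 0 (swirlTravelGradient driftCentre) M 0 1
    (fun a _ => swirlTravel_hasWeakSpatialGradientOn (contDiffOn_driftCentre (n := 1)) a)
    (fun a _ => hM a) (fun z₀ _ r _ => (cknD_zero r z₀).le) (swirlTravel_rate driftCentre)
    (swirlTravel_nullTop driftCentre) swirlSpread_isSpread
  -- a late time `s = −2ε` in the strip `]−δ, −ε[` with `‖c(s)‖ = 1/(2ε) > R`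
  set ε : ℝ := min (δ / 4) (1 / (4 * (R + 1))) with hε
  have hε0 : 0 < ε := lt_min (by positivity) (by positivity)
  have hεδ : ε ≤ δ / 4 := min_le_left _ _
  have hεR : ε ≤ 1 / (4 * (R + 1)) := min_le_right _ _
  have hs : (-(2 * ε) : ℝ) ∈ Ioo (-δ) (-ε) := ⟨by linarith, by linarith⟩
  have hcont : ContinuousOn (uncurry (swirlTravel driftCentre))
      (Ioo (-δ) (-ε) ×ˢ (univ : Set (EuclideanSpace ℝ (Fin 3)))) :=
    (contDiffOn_swirlTravel (n := 0) (contDiffOn_driftCentre (n := 0))).continuousOn.mono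
      (prod_mono (fun s hs' => show s < 0 by linarith [hs'.2]) Subset.rfl)
  have hcurl := h' ε hε0 (by linarith) (swirlTravel driftCentre) EventuallyEq.rfl hcont
    (fun z _ => (contDiff_swirlTravel_slice driftCentre z.1).contDiffAt)
    (fun z _ => divergence_swirlTravel driftCentre z.1 z.2) (-(2 * ε)) hs (driftCentre (-(2 * ε))) (by
      rw [norm_driftCentre (by linarith), neg_neg]
      have h2ε : 2 * ε ≤ 1 / (2 * (R + 1)) := by
        calc 2 * ε ≤ 2 * (1 / (4 * (R + 1))) := by gcongr
          _ = 1 / (2 * (R + 1)) := by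
              rw [mul_one_div, div_eq_div_iff (by positivity) (by positivity)]; ring
      have h1 : 2 * (R + 1) ≤ (2 * ε)⁻¹ := by
        rw [le_inv_comm₀ (by positivity) (by positivity), inv_eq_one_div]; exact h2ε
      linarith)
  exact curl_swirlTravel_centre_ne_zero driftCentre (by linarith) hcurl


/-! ### The exterior vorticity backward-uniqueness statement is false without its Navier–Stokes clause -/

/-- **Type-I derivative bound of the travelling swirl**: `‖∇U(s, y)‖ ≤ (1/2 + 4L)/(−s)`. [folklore] -/
theorem norm_fderiv_swirlTravel_le {L : ℝ} (hL0 : 0 ≤ L) (hL : ∀ s, |deriv ParabolicBump.cutoff s| ≤ L)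
    (c : ℝ → EuclideanSpace ℝ (Fin 3)) {s : ℝ} (hs : s < 0) (y : EuclideanSpace ℝ (Fin 3)) :
    ‖fderiv ℝ (swirlTravel c s) y‖ ≤ (1 / 2 + 4 * L) / (-s) := by
  rw [fderiv_swirlTravel]
  show ‖swirlGradient s (y - c s)‖ ≤ (1 / 2 + 4 * L) / (-s)
  by_cases hy : ‖y - c s‖ ≤ 2 * Real.sqrt (-s)
  · exact norm_swirlGradient_le hL0 hL hs hy
  · rw [swirlGradient_eq_zero_of hs (lt_of_not_ge hy).le, norm_zero]
    have : 0 < -s := by linarith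
    positivity

/-- **The exterior VORTICITY backward-uniqueness statement with Type-I coefficients (s25-3, the disprover's
`ExteriorVorticityBUTypeI`) minus its Navier–Stokes clause is FALSE**: the divergence-free travelling swirl along
the escaping path `c(s) = (−s)⁻¹e₀` obeys `‖U‖ ≤ C/√(−s)`, `‖∇U‖ ≤ C/(−s)` everywhere, has a null top against
every test field (pointwise in `s`), yet `curl U(s,·)(c(s)) ≠ 0` with `‖c(s)‖ = (−s)⁻¹` beyond every radius
`R'` at late `s ∈ ]−1,0[`.  So a proof of exterior irrotationality must use that `ω = curl U` solves the
vorticity equation.  Not NS; NS regularity neither proved nor refuted. [folklore; EscauriazaSereginSverak2003 §5] -/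
theorem exteriorVorticityBUTypeI_false_without_NS :
    ¬ (∀ (R C : ℝ) (U : ℝ → EuclideanSpace ℝ (Fin 3) → EuclideanSpace ℝ (Fin 3))
      (_P : ℝ → EuclideanSpace ℝ (Fin 3) → ℝ), 1 ≤ R →
      (∀ s ∈ Ioo (-1 : ℝ) 0, ∀ y ∈ (closedBall (0 : EuclideanSpace ℝ (Fin 3)) R)ᶜ,
        ‖U s y‖ ≤ C / Real.sqrt (-s) ∧ ‖fderiv ℝ (U s) y‖ ≤ C / (-s)) →
      (∀ φ : EuclideanSpace ℝ (Fin 3) → EuclideanSpace ℝ (Fin 3), ContDiff ℝ (⊤ : ℕ∞) φ →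
        HasCompactSupport φ → tsupport φ ⊆ (closedBall (0 : EuclideanSpace ℝ (Fin 3)) R)ᶜ →
        ∀ ε : ℝ, 0 < ε → ∃ s₀ : ℝ, s₀ < 0 ∧ ∀ s ∈ Ioo s₀ 0, |∫ y, ⟪U s y, φ y⟫| ≤ ε) →
      ∃ R' : ℝ, R ≤ R' ∧ ∀ s ∈ Ioo (-1 : ℝ) 0,
        ∀ y ∈ (closedBall (0 : EuclideanSpace ℝ (Fin 3)) R')ᶜ, curl (U s) y = 0) := by
  intro h
  obtain ⟨L, hL0, hL⟩ := ParabolicBump.exists_bound_deriv_cutoff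
  set C : ℝ := 1 / 2 + 4 * L + 1 with hC
  have hC1 : 1 ≤ C := by rw [hC]; linarith
  have hbounds : ∀ s ∈ Ioo (-1 : ℝ) 0, ∀ y ∈ (closedBall (0 : EuclideanSpace ℝ (Fin 3)) 1)ᶜ,
      ‖swirlTravel driftCentre s y‖ ≤ C / Real.sqrt (-s) ∧
        ‖fderiv ℝ (swirlTravel driftCentre s) y‖ ≤ C / (-s) := by
    intro s hs y _
    have hs0 : s < 0 := hs.2
    have hns : 0 < -s := by linarith
    refine ⟨(norm_swirlTravel_le driftCentre hs0 y).trans ?_,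
      (norm_fderiv_swirlTravel_le hL0 hL driftCentre hs0 y).trans ?_⟩
    · exact div_le_div_of_nonneg_right hC1 (Real.sqrt_nonneg _)
    · exact div_le_div_of_nonneg_right (by rw [hC]; linarith) hns.le
  obtain ⟨R', -, hcurl⟩ := h 1 C (swirlTravel driftCentre) 0 le_rfl hbounds
    (fun φ hφ hφc _ ε hε => swirlTravel_nullTop_pointwise driftCentre φ hφ hφc ε hε)
  -- a late time with `‖c(s)‖ = (−s)⁻¹ > R'`
  have hR1 : 0 < |R'| + 1 := by positivity
  set τ : ℝ := min (1 / 2) (1 / (|R'| + 1)) with hτ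
  have hτ0 : 0 < τ := lt_min (by norm_num) (by positivity)
  have hτ1 : τ ≤ 1 / 2 := min_le_left _ _
  have hτR : τ ≤ 1 / (|R'| + 1) := min_le_right _ _
  have hs : (-τ : ℝ) ∈ Ioo (-1 : ℝ) 0 := ⟨by linarith, by linarith⟩
  have hmem : driftCentre (-τ) ∈ (closedBall (0 : EuclideanSpace ℝ (Fin 3)) R')ᶜ := by
    rw [mem_compl_iff, mem_closedBall, dist_zero_right, not_le, norm_driftCentre (by linarith), neg_neg]
    have h1 : |R'| + 1 ≤ τ⁻¹ := by
      rw [le_inv_comm₀ hR1 hτ0, inv_eq_one_div]; exact hτR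
    linarith [le_abs_self R']
  exact curl_swirlTravel_centre_ne_zero driftCentre (by linarith) (hcurl (-τ) hs _ hmem)

end Summit.NavierStokesRegularity.NavierStokesRegularity.Theorems.TypeITraceScarL3.Negative

end
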